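import Literature.NumberTheory.GaloisRepresentations.SuperellipticReductionLocal
import HarnessLib
/-!
# Reduction of `y^p = f(x)` modulo `𝔓`: principal divisors reduce to principal divisors

Part 3 of the explicit Deuring reduction (`SuperellipticReduction`, `SuperellipticReductionLocal`).

* Fibre sums over `x = a` are root multiplicities of the norm form `Nm(u)` (`sum_fibK_principalDivisor_ev`,
  `sum_fibκ_principalDivisor_evκ`, from `sum_ord_fibre_eq_ord_norm` and `norm_polyEval`), and the roots of `Nm(u)`
  in `ℤ̄_𝔓` reduce onto the roots of `Nm(u) mod 𝔓` with multiplicities (`rootMultiplicity_map_absIntegersResidue`);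
  hence the fibre sums of `(ū) - (u)‾` vanish (`sum_fibκ_sub_eq_zero`).
* With the local inequality at unramified points and `deg (ū) = deg (u)‾ = 0` this gives
  **`(u)‾ = (ū)`** for `ū(x̄,ȳ) ≠ 0` (`redDiv_principalDivisor_ev`).
* Every `z ≠ 0` in `K̄(C_f)` is `c · u(x,y)/v(x,y)` with `ū, v̄ ≠ 0` on the special fibre and `c ∈ K̄ˣ`
  (`exists_mul_ev_eq_smul_ev`: clear denominators, then divide the coefficients by one of maximal `𝔓`-adic size);
  hence **the reduction of every principal divisor is principal** (`isPrincipal_redDiv_principalDivisor`,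
  `principalDivisors_le_comap_redDiv`).

## References
* [cite: Deuring1942Reduktion, §3]
* [cite: Stichtenoth2009, Thm. 3.1.11]
-/

noncomputable section

open Polynomial
open scoped NumberField Classical Polynomial.Bivariate

namespace Literature.NumberTheory.GaloisRepresentations

open Field IsDedekindDomain Literature.NumberTheory.DiophantineGeometry
  Literature.NumberTheory.DiophantineGeometry.AlgFunctionField SuperellipticFunctionField

attribute [local instance] Ideal.Quotient.field

set_option synthInstance.maxHeartbeats 160000

namespace SuperellipticReduction

variable {K : Type} [Field K] [NumberField K] {p : ℕ} [hp : Fact p.Prime] {f₀ : (𝓞 K)[X]}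
variable {𝔭 : HeightOneSpectrum (𝓞 K)} {𝔓 : Ideal (absIntegers (𝓞 K) K)} [h𝔓m : 𝔓.IsMaximal] [h𝔓 : 𝔓.LiesOver 𝔭.asIdeal]

set_option hygiene false in
local notation "K̄" => AlgebraicClosure K
set_option hygiene false in
local notation "𝒪" => absIntegersLocalization 𝔓
set_option hygiene false in
local notation "κ" => (absIntegers (𝓞 K) K ⧸ 𝔓)
set_option hygiene false in
local notation "k𝔭" => (𝓞 K ⧸ 𝔭.asIdeal)
set_option hygiene false in
local notation "fK" => (Polynomial.map (algebraMap (𝓞 K) K) f₀)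
set_option hygiene false in
local notation "fk" => (Polynomial.map (Ideal.Quotient.mk 𝔭.asIdeal) f₀)
set_option hygiene false in
local notation "FK" => SuperellipticFunctionField K (AlgebraicClosure K) p (Polynomial.map (algebraMap (𝓞 K) K) f₀)
set_option hygiene false in
local notation "Fκ" =>
  SuperellipticFunctionField (𝓞 K ⧸ 𝔭.asIdeal) (absIntegers (𝓞 K) K ⧸ 𝔓) p (Polynomial.map (Ideal.Quotient.mk 𝔭.asIdeal) f₀)
set_option hygiene false in
/-- evaluation in the generic fibre -/
local notation "ev" =>
  polyEval K p (Polynomial.map (algebraMap (𝓞 K) K) f₀) (absIntegersLocalization 𝔓).subtype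
set_option hygiene false in
/-- evaluation in the special fibre -/
local notation "evκ" =>
  polyEval (𝓞 K ⧸ 𝔭.asIdeal) p (Polynomial.map (Ideal.Quotient.mk 𝔭.asIdeal) f₀) (absIntegersResidue 𝔓)
set_option hygiene false in
/-- the model `Y^p - f_𝒪` -/
local notation "gmod" => ((X : (absIntegersLocalization 𝔓)[X][Y]) ^ p - C (fLoc f₀ 𝔓))

variable [hirrK : Fact (Irreducible (superellipticPoly K (AlgebraicClosure K) p (fK)))]
  [hirrκ : Fact (Irreducible (superellipticPoly (𝓞 K ⧸ 𝔭.asIdeal) (absIntegers (𝓞 K) K ⧸ 𝔓) p (fk)))]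

set_option hygiene false in
/-- the places of `K̄(C_f)` above `x = a` -/
local notation "fibK" a:max =>
  (PlaceOver.finite_setOf_restrict_eq (K := AlgebraicClosure K) (F := RatFunc (AlgebraicClosure K))
    (F' := SuperellipticFunctionField K (AlgebraicClosure K) p (Polynomial.map (algebraMap (𝓞 K) K) f₀))
    (placeXSubC a)).toFinset
set_option hygiene false in
/-- the places of `κ(C_f̄)` above `x̄ = α` -/
local notation "fibκ" α:max =>
  (PlaceOver.finite_setOf_restrict_eq (K := (absIntegers (𝓞 K) K ⧸ 𝔓)) (F := RatFunc (absIntegers (𝓞 K) K ⧸ 𝔓))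
    (F' := SuperellipticFunctionField (𝓞 K ⧸ 𝔭.asIdeal) (absIntegers (𝓞 K) K ⧸ 𝔓) p
      (Polynomial.map (Ideal.Quotient.mk 𝔭.asIdeal) f₀))
    (placeXSubC α)).toFinset
set_option hygiene false in
/-- the norm form of `u` over `K̄` -/
local notation "NmK" u:max => (Polynomial.map (absIntegersLocalization 𝔓).subtype (modelNorm p (fLoc f₀ 𝔓) u))
set_option hygiene false in
/-- the norm form of `u` over `κ` -/
local notation "Nmκ" u:max => (Polynomial.map (absIntegersResidue 𝔓) (modelNorm p (fLoc f₀ 𝔓) u))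

/-! ### Fibre sums are root multiplicities of the norm form -/

section Generic

omit [NumberField K] hirrκ in
/-- `Nm(u)` is nonzero over `K̄` when `u(x,y) ≠ 0`. [folklore] -/
theorem normK_ne_zero {u : (absIntegersLocalization 𝔓)[X][Y]} (hu : ev u ≠ 0) : NmK u ≠ 0 := by
  intro h0
  have h := norm_polyEval (k := K) (absIntegersLocalization 𝔓).subtype (fLoc_map_subtype (𝔓 := 𝔓) (f₀ := f₀)) hp.out.ne_zero u
  rw [coeffHom_apply, h0, map_zero, Algebra.norm_eq_zero_iff] at h
  exact hu h

variable {ζ₀ : K̄} (hζ₀ : IsPrimitiveRoot ζ₀ p) (hsepK : (fK).Separable)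
include hζ₀ hsepK

omit [NumberField K] hirrκ in
/-- **Generic fibre sums**: `∑_{Q | x = a} v_Q(u(x,y)) = mult_a Nm(u)` over `K̄`. [cite: Stichtenoth2009, Thm. 3.1.11] -/
theorem sum_fibK_principalDivisor_ev {u : (absIntegersLocalization 𝔓)[X][Y]} (hu : ev u ≠ 0) (a : K̄) :
    ∑ Q ∈ fibK a, principalDivisor K̄ (ev u) Q = (NmK u).rootMultiplicity a := by
  have h := sum_ord_fibre_eq_ord_norm (k := K) hζ₀ hsepK hu a
  rw [norm_polyEval (k := K) (absIntegersLocalization 𝔓).subtype (fLoc_map_subtype (𝔓 := 𝔓) (f₀ := f₀)) hp.out.ne_zero u,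
    coeffHom_apply, ord_placeXSubC_algebraMap_eq_rootMultiplicity (normK_ne_zero hu)] at h
  rw [← h]
  exact Finset.sum_congr rfl fun Q _ => principalDivisor_apply_of_ne_zero hu Q

omit hirrκ in
/-- Places above `x = a`, `a ∈ ℤ̄_𝔓`, are places of integral points. [folklore] -/
theorem exists_eq_pointPlace_of_mem_fibK {a : 𝒪} {Q : PlaceOver K̄ FK} (hQ : Q ∈ fibK (a : K̄)) :
    ∃ b : 𝒪, (b : K̄) ^ p = ((fK).map (algebraMap K K̄)).eval (a : K̄) ∧ Q = pointPlace K K̄ p (fK) (a : K̄) (b : K̄) := by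
  obtain ⟨b, hb, rfl⟩ := exists_eq_pointPlace hζ₀ hsepK (((placeXSubC (a : K̄)).mem_toFinset_restrict_eq_iff Q).1 hQ)
  exact ⟨⟨b, mem_of_pow_eq_eval hb⟩, hb, rfl⟩

omit hirrκ in
/-- `v_Q(u(x,y)) ≥ 0` at the places above an integral `x = a`. [folklore] -/
theorem principalDivisor_ev_nonneg_of_mem_fibK {u : (absIntegersLocalization 𝔓)[X][Y]} (hu : ev u ≠ 0) {a : 𝒪}
    {Q : PlaceOver K̄ FK} (hQ : Q ∈ fibK (a : K̄)) : 0 ≤ principalDivisor K̄ (ev u) Q := by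
  obtain ⟨b, hb, rfl⟩ := exists_eq_pointPlace_of_mem_fibK hζ₀ hsepK hQ
  rw [principalDivisor_apply_of_ne_zero hu]
  exact ord_ev_nonneg hζ₀ hsepK hb hu

end Generic

section Special

omit hirrK in
/-- `Nm(u) mod 𝔓` is nonzero when `ū(x,y) ≠ 0`. [folklore] -/
theorem normκ_ne_zero {u : (absIntegersLocalization 𝔓)[X][Y]} (hu : evκ u ≠ 0) : Nmκ u ≠ 0 := by
  haveI : IsAlgClosed κ := absIntegers.isAlgClosed_quotient 𝔓
  intro h0
  have h := norm_polyEval (k := k𝔭) (absIntegersResidue 𝔓) (fLoc_map_residue (𝔭 := 𝔭) (f₀ := f₀)) hp.out.ne_zero u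
  rw [coeffHom_apply, h0, map_zero, Algebra.norm_eq_zero_iff] at h
  exact hu h

variable {ζ₀' : κ} (hζ₀' : IsPrimitiveRoot ζ₀' p) (hsepk : (fk).Separable)
include hζ₀' hsepk

omit hirrK in
/-- **Special fibre sums**: `∑_{Q̄ | x̄ = α} v_Q̄(ū(x,y)) = mult_α (Nm(u) mod 𝔓)`. [cite: Stichtenoth2009, Thm. 3.1.11] -/
theorem sum_fibκ_principalDivisor_evκ {u : (absIntegersLocalization 𝔓)[X][Y]} (hu : evκ u ≠ 0) (α : κ) :
    ∑ Q' ∈ fibκ α, principalDivisor κ (evκ u) Q' = (Nmκ u).rootMultiplicity α := by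
  haveI : IsAlgClosed κ := absIntegers.isAlgClosed_quotient 𝔓
  have h := sum_ord_fibre_eq_ord_norm (k := k𝔭) hζ₀' hsepk hu α
  rw [norm_polyEval (k := k𝔭) (absIntegersResidue 𝔓) (fLoc_map_residue (𝔭 := 𝔭) (f₀ := f₀)) hp.out.ne_zero u,
    coeffHom_apply, ord_placeXSubC_algebraMap_eq_rootMultiplicity (normκ_ne_zero (𝔭 := 𝔭) hu)] at h
  rw [← h]
  exact Finset.sum_congr rfl fun Q _ => principalDivisor_apply_of_ne_zero hu Q

end Special

/-! ### The fibre sums of the reduced divisor -/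

section Fibres

variable {ζ₀ : K̄} (hζ₀ : IsPrimitiveRoot ζ₀ p) {ζ₀' : κ} (hζ₀' : IsPrimitiveRoot ζ₀' p)
  (hsepK : (fK).Separable) (hsepk : (fk).Separable)
include hζ₀ hζ₀' hsepK hsepk

/-- **Which places of `supp (u)` reduce into the fibre `x̄ = α`**: exactly those above some `x = a` with
`a ∈ ℤ̄_𝔓`, `ā = α`, `a` a root of `Nm(u)`. [folklore] -/
theorem redPlace_mem_fibκ_iff {u : (absIntegersLocalization 𝔓)[X][Y]} (hu : ev u ≠ 0) (α : κ) {Q : PlaceOver K̄ FK}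
    (hQ : principalDivisor K̄ (ev u) Q ≠ 0) :
    redPlace 𝔭 𝔓 Q ∈ fibκ α ↔ ∃ a ∈ (NmK u).roots.toFinset.filter
      (fun a => a ∈ absIntegersLocalization 𝔓 ∧ absIntegersResidue' 𝔓 a = α), Q ∈ fibK a := by
  haveI : IsAlgClosed κ := absIntegers.isAlgClosed_quotient 𝔓
  constructor
  · intro hred
    have hres : (redPlace 𝔭 𝔓 Q).restrict (K := κ) (F := RatFunc κ) = placeXSubC α :=
      ((placeXSubC α).mem_toFinset_restrict_eq_iff _).1 hred
    have hne : redPlace 𝔭 𝔓 Q ≠ inftyPlace k𝔭 κ p (fk) := fun h =>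
      placeXSubC_ne_ratFuncInftyPlace α (hres.symm.trans (h ▸ restrict_inftyPlace))
    obtain ⟨a, b, hb, rfl⟩ := exists_eq_pointPlace_of_redPlace_ne_inftyPlace hne
    rw [redPlace_pointPlace hζ₀ hsepK a b hb, restrict_pointPlace hζ₀' hsepk (residue_pow_eq_eval hb)] at hres
    have hα : absIntegersResidue 𝔓 a = α := placeXSubC_injective hres
    have hQmem : pointPlace K K̄ p (fK) (a : K̄) (b : K̄) ∈ fibK (a : K̄) :=
      ((placeXSubC (a : K̄)).mem_toFinset_restrict_eq_iff _).2 (restrict_pointPlace hζ₀ hsepK hb)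
    refine ⟨a, Finset.mem_filter.2 ⟨?_, a.2, by rw [absIntegersResidue'_coe, hα]⟩, hQmem⟩
    -- `a` is a root of `Nm(u)`: the fibre sum over `x = a` is positive
    rw [Multiset.mem_toFinset, mem_roots (normK_ne_zero hu), ← rootMultiplicity_pos (normK_ne_zero hu),
      ← Int.natCast_pos, ← sum_fibK_principalDivisor_ev hζ₀ hsepK hu]
    refine Finset.sum_pos' (fun Q' hQ' => principalDivisor_ev_nonneg_of_mem_fibK hζ₀ hsepK hu hQ') ⟨_, hQmem, ?_⟩
    exact lt_of_le_of_ne (principalDivisor_ev_nonneg_of_mem_fibK hζ₀ hsepK hu hQmem) hQ.symm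
  · rintro ⟨a, ha, hQa⟩
    obtain ⟨haO, hα⟩ := (Finset.mem_filter.1 ha).2
    obtain ⟨b, hb, rfl⟩ := exists_eq_pointPlace_of_mem_fibK hζ₀ hsepK (a := ⟨a, haO⟩) hQa
    rw [redPlace_pointPlace hζ₀ hsepK _ b hb]
    refine ((placeXSubC α).mem_toFinset_restrict_eq_iff _).2 ?_
    rw [restrict_pointPlace hζ₀' hsepk (residue_pow_eq_eval hb), ← absIntegersResidue'_of_mem 𝔓 haO, hα]

/-- **Fibre sums of the reduced divisor**: `∑_{Q̄ | x̄ = α} (u)‾(Q̄) = ∑_{a ∈ ℤ̄_𝔓 root of Nm(u), ā = α} mult_a Nm(u)`.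
[folklore] -/
theorem sum_fibκ_redDiv {u : (absIntegersLocalization 𝔓)[X][Y]} (hu : ev u ≠ 0) (α : κ) :
    ∑ Q' ∈ fibκ α, redDiv 𝔭 𝔓 (principalDivisor K̄ (ev u)) Q' =
      ∑ a ∈ (NmK u).roots.toFinset.filter (fun a => a ∈ absIntegersLocalization 𝔓 ∧ absIntegersResidue' 𝔓 a = α),
        (NmK u).rootMultiplicity a := by
  set D := principalDivisor K̄ (ev u) with hD
  set A := (NmK u).roots.toFinset.filter (fun a => a ∈ absIntegersLocalization 𝔓 ∧ absIntegersResidue' 𝔓 a = α)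
    with hA
  -- Step 1: regroup the double sum over the reduced places
  have h1 : ∑ Q' ∈ fibκ α, redDiv 𝔭 𝔓 D Q' = ∑ Q ∈ D.support.filter (fun Q => redPlace 𝔭 𝔓 Q ∈ fibκ α), D Q := by
    rw [← Finset.sum_fiberwise_of_maps_to (s := D.support.filter (fun Q => redPlace 𝔭 𝔓 Q ∈ fibκ α))
      (t := fibκ α) (g := redPlace 𝔭 𝔓) (fun Q hQ => (Finset.mem_filter.1 hQ).2)]
    refine Finset.sum_congr rfl fun Q' hQ' => ?_
    rw [redDiv_apply, Finset.filter_filter]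
    refine Finset.sum_congr (Finset.filter_congr fun Q _ => ?_) fun _ _ => rfl
    exact ⟨fun h => ⟨h ▸ hQ', h⟩, fun h => h.2⟩
  -- Step 2: the places reducing into the fibre are the places above the `a ∈ A`
  have hdisj : (A : Set K̄).PairwiseDisjoint (fun a => fibK a) := by
    intro a _ a' _ hne
    refine Finset.disjoint_left.2 fun Q hQ hQ' => hne ?_
    have h := ((placeXSubC a).mem_toFinset_restrict_eq_iff Q).1 hQ
    rw [((placeXSubC a').mem_toFinset_restrict_eq_iff Q).1 hQ'] at h
    exact (placeXSubC_injective h).symm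
  have h2 : D.support.filter (fun Q => redPlace 𝔭 𝔓 Q ∈ fibκ α) = (A.biUnion fun a => fibK a).filter (fun Q => D Q ≠ 0) := by
    ext Q
    simp only [Finset.mem_filter, Finsupp.mem_support_iff, Finset.mem_biUnion]
    constructor
    · rintro ⟨hQ, hred⟩
      exact ⟨(redPlace_mem_fibκ_iff hζ₀ hζ₀' hsepK hsepk hu α hQ).1 hred, hQ⟩
    · rintro ⟨hex, hQ⟩
      exact ⟨hQ, (redPlace_mem_fibκ_iff hζ₀ hζ₀' hsepK hsepk hu α hQ).2 hex⟩
  rw [h1, h2, Finset.sum_filter_ne_zero, Finset.sum_biUnion hdisj, Nat.cast_sum]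
  exact Finset.sum_congr rfl fun a _ => sum_fibK_principalDivisor_ev hζ₀ hsepK hu a

/-- **The fibre sums of `(ū) - (u)‾` vanish.** [cite: Deuring1942Reduktion, §3] -/
theorem sum_fibκ_sub_eq_zero {u : (absIntegersLocalization 𝔓)[X][Y]} (hu : evκ u ≠ 0) (α : κ) :
    ∑ Q' ∈ fibκ α, (principalDivisor κ (evκ u) - redDiv 𝔭 𝔓 (principalDivisor K̄ (ev u))) Q' = 0 := by
  have hu0 : ev u ≠ 0 := ev_ne_zero_of_evκ_ne_zero hu
  simp only [Finsupp.sub_apply, Finset.sum_sub_distrib]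
  rw [sum_fibκ_principalDivisor_evκ hζ₀' hsepk hu, sum_fibκ_redDiv hζ₀ hζ₀' hsepK hsepk hu0,
    rootMultiplicity_map_absIntegersResidue 𝔓 _ (normκ_ne_zero (𝔭 := 𝔭) hu), sub_self]

end Fibres

/-! ### The main theorem: `(u)‾ = (ū)` -/

section Main

variable (hp𝔭 : (p : 𝓞 K) ∉ 𝔭.asIdeal) {ζ₀ : K̄} (hζ₀ : IsPrimitiveRoot ζ₀ p) {ζ₀' : κ} (hζ₀' : IsPrimitiveRoot ζ₀' p)
  (hsepK : (fK).Separable) (hsepk : (fk).Separable) (hndvdk : ¬ p ∣ (fk).natDegree)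
include hp𝔭 hζ₀ hζ₀' hsepK hsepk hndvdk

omit hndvdk in
/-- **Pointwise inequality at unramified points**: `(u)‾(Q̄) ≤ (ū)(Q̄)` for `Q̄ = (α, β)`, `f̄(α) ≠ 0`. [cite: Deuring1942Reduktion, §3] -/
theorem redDiv_apply_le {u : (absIntegersLocalization 𝔓)[X][Y]} (hu : evκ u ≠ 0) {α β : κ}
    (hαβ : β ^ p = ((fk).map (algebraMap k𝔭 κ)).eval α) (hα : ((fk).map (algebraMap k𝔭 κ)).eval α ≠ 0) :
    redDiv 𝔭 𝔓 (principalDivisor K̄ (ev u)) (pointPlace k𝔭 κ p (fk) α β) ≤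
      principalDivisor κ (evκ u) (pointPlace k𝔭 κ p (fk) α β) := by
  have hu0 : ev u ≠ 0 := ev_ne_zero_of_evκ_ne_zero hu
  rw [redDiv_apply, principalDivisor_apply_of_ne_zero hu,
    Finset.sum_congr rfl fun Q _ => principalDivisor_apply_of_ne_zero hu0 Q]
  exact sum_ord_le_ord_of_redPlace_eq hp𝔭 hζ₀ hζ₀' hsepK hsepk hu hαβ hα

omit hndvdk in
/-- **`(ū) - (u)‾` vanishes at every affine place.** [cite: Deuring1942Reduktion, §3] -/
theorem sub_apply_pointPlace_eq_zero {u : (absIntegersLocalization 𝔓)[X][Y]} (hu : evκ u ≠ 0) {α β : κ}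
    (hαβ : β ^ p = ((fk).map (algebraMap k𝔭 κ)).eval α) :
    (principalDivisor κ (evκ u) - redDiv 𝔭 𝔓 (principalDivisor K̄ (ev u))) (pointPlace k𝔭 κ p (fk) α β) = 0 := by
  haveI : IsAlgClosed κ := absIntegers.isAlgClosed_quotient 𝔓
  set E := principalDivisor κ (evκ u) - redDiv 𝔭 𝔓 (principalDivisor K̄ (ev u)) with hE
  have hsum := sum_fibκ_sub_eq_zero hζ₀ hζ₀' hsepK hsepk hu α
  have hmem : pointPlace k𝔭 κ p (fk) α β ∈ fibκ α :=
    ((placeXSubC α).mem_toFinset_restrict_eq_iff _).2 (restrict_pointPlace hζ₀' hsepk hαβ)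
  by_cases hα : ((fk).map (algebraMap k𝔭 κ)).eval α = 0
  · -- ramified: the fibre is the single place `(α, 0)`
    have hfib : ∀ Q' ∈ fibκ α, Q' = pointPlace k𝔭 κ p (fk) α β := by
      intro Q' hQ'
      obtain ⟨β', hβ', rfl⟩ := exists_eq_pointPlace hζ₀' hsepk (((placeXSubC α).mem_toFinset_restrict_eq_iff Q').1 hQ')
      have h0 : β' = 0 := pow_eq_zero_iff (n := p) hp.out.ne_zero |>.1 (by rw [hβ', hα])
      have h0' : β = 0 := pow_eq_zero_iff (n := p) hp.out.ne_zero |>.1 (by rw [hαβ, hα])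
      rw [h0, h0']
    rw [Finset.sum_eq_single_of_mem _ hmem fun Q' hQ' hne => absurd (hfib Q' hQ') hne] at hsum
    exact hsum
  · -- unramified: all terms of the vanishing fibre sum are `≥ 0`
    have hnonneg : ∀ Q' ∈ fibκ α, 0 ≤ E Q' := by
      intro Q' hQ'
      obtain ⟨β', hβ', rfl⟩ := exists_eq_pointPlace hζ₀' hsepk (((placeXSubC α).mem_toFinset_restrict_eq_iff Q').1 hQ')
      rw [hE, Finsupp.sub_apply, sub_nonneg]
      exact redDiv_apply_le hp𝔭 hζ₀ hζ₀' hsepK hsepk hu hβ' hα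
    exact (Finset.sum_eq_zero_iff_of_nonneg hnonneg).1 hsum _ hmem

/-- **Deuring's reduction of principal divisors (explicit form)**: for `u ∈ ℤ̄_𝔓[X][Y]` with `ū(x, y) ≠ 0` in
`κ(C_f̄)`, the reduction of the divisor of `u(x,y) ∈ K̄(C_f)` is the divisor of `ū(x,y)`: `(u)‾ = (ū)`.
The difference vanishes at the affine places (fibre sums via norms + the local inequality) and has degree `0`
(reduction preserves degrees, principal divisors have degree `0`), hence vanishes at `∞̄` too. [cite: Deuring1942Reduktion, §3] -/
theorem redDiv_principalDivisor_ev {u : (absIntegersLocalization 𝔓)[X][Y]} (hu : evκ u ≠ 0) :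
    redDiv 𝔭 𝔓 (principalDivisor K̄ (ev u)) = principalDivisor κ (evκ u) := by
  haveI : IsAlgClosed κ := absIntegers.isAlgClosed_quotient 𝔓
  have hu0 : ev u ≠ 0 := ev_ne_zero_of_evκ_ne_zero hu
  set E := principalDivisor κ (evκ u) - redDiv 𝔭 𝔓 (principalDivisor K̄ (ev u)) with hE
  suffices h : E = 0 by rw [hE, sub_eq_zero] at h; exact h.symm
  -- `E` is supported at `∞̄`
  have hsupp : E.support ⊆ {inftyPlace k𝔭 κ p (fk)} := by
    intro Q' hQ'
    rw [Finset.mem_singleton]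
    rcases eq_inftyPlace_or_exists_eq_pointPlace hζ₀' hsepk hndvdk Q' with h | ⟨α, β, hαβ, rfl⟩
    · exact h
    · exact absurd (sub_apply_pointPlace_eq_zero hp𝔭 hζ₀ hζ₀' hsepK hsepk hu hαβ) (Finsupp.mem_support_iff.1 hQ')
  rw [Finsupp.support_subset_singleton] at hsupp
  -- and has degree `0`
  have hdeg : E.degree = 0 := by
    rw [hE, map_sub, degree_redDiv, degree_principalDivisor_eq_zero hu, degree_principalDivisor_eq_zero hu0, sub_zero]
  rw [hsupp, Divisor.degree_single, PlaceOver.isRational_of_isAlgClosed, Nat.cast_one, mul_one] at hdeg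
  rw [hsupp, hdeg, Finsupp.single_zero]

end Main

end SuperellipticReduction

namespace SuperellipticFunctionField

variable {k : Type*} [Field k] {Λ : Type*} [Field Λ] [Algebra k Λ] {p : ℕ} {f : k[X]}
variable [Fact (Irreducible (superellipticPoly k Λ p f))] {R : Type*} [CommRing R]

/-- `u^φ(x, y) = ∑_i (u_i)^φ(x) y^i` for `deg_Y u < n`. [folklore] -/
theorem polyEval_eq_sum_range (φ : R →+* Λ) (u : R[X][Y]) {n : ℕ} (hn : u.natDegree < n) :
    polyEval k p f φ u = ∑ i ∈ Finset.range n,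
      algebraMap Λ[X] (SuperellipticFunctionField k Λ p f) ((u.coeff i).map φ) * genY k Λ p f ^ i := by
  rw [polyEval_apply, ← AdjoinRoot.aeval_eq, aeval_eq_sum_range' (lt_of_le_of_lt natDegree_map_le hn)]
  refine Finset.sum_congr rfl fun i _ => ?_
  rw [coeff_map, Algebra.smul_def, coeffHom_apply,
    IsScalarTower.algebraMap_apply Λ[X] (RatFunc Λ) (SuperellipticFunctionField k Λ p f)]
  rfl

/-- **Change of coefficients**: `polyEval ψ (u^{φ'}) = polyEval (ψ ∘ φ') u`. [folklore] -/
theorem polyEval_map_mapRingHom {R' : Type*} [CommRing R'] (ψ : R' →+* Λ) (φ' : R →+* R') (u : R[X][Y]) :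
    polyEval k p f ψ (u.map (mapRingHom φ')) = polyEval k p f (ψ.comp φ') u := by
  rw [polyEval_apply, polyEval_apply, Polynomial.map_map]
  congr 1
  simp only [coeffHom, RingHom.comp_assoc, mapRingHom_comp]

end SuperellipticFunctionField

namespace SuperellipticReduction

variable {K : Type} [Field K] [NumberField K] {p : ℕ} [hp : Fact p.Prime] {f₀ : (𝓞 K)[X]}
variable {𝔭 : HeightOneSpectrum (𝓞 K)} {𝔓 : Ideal (absIntegers (𝓞 K) K)} [h𝔓m : 𝔓.IsMaximal] [h𝔓 : 𝔓.LiesOver 𝔭.asIdeal]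

set_option hygiene false in
local notation "K̄" => AlgebraicClosure K
set_option hygiene false in
local notation "𝒪" => absIntegersLocalization 𝔓
set_option hygiene false in
local notation "κ" => (absIntegers (𝓞 K) K ⧸ 𝔓)
set_option hygiene false in
local notation "k𝔭" => (𝓞 K ⧸ 𝔭.asIdeal)
set_option hygiene false in
local notation "fK" => (Polynomial.map (algebraMap (𝓞 K) K) f₀)
set_option hygiene false in
local notation "fk" => (Polynomial.map (Ideal.Quotient.mk 𝔭.asIdeal) f₀)
set_option hygiene false in
local notation "FK" => SuperellipticFunctionField K (AlgebraicClosure K) p (Polynomial.map (algebraMap (𝓞 K) K) f₀)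
set_option hygiene false in
local notation "Fκ" =>
  SuperellipticFunctionField (𝓞 K ⧸ 𝔭.asIdeal) (absIntegers (𝓞 K) K ⧸ 𝔓) p (Polynomial.map (Ideal.Quotient.mk 𝔭.asIdeal) f₀)
set_option hygiene false in
/-- evaluation in the generic fibre -/
local notation "ev" =>
  polyEval K p (Polynomial.map (algebraMap (𝓞 K) K) f₀) (absIntegersLocalization 𝔓).subtype
set_option hygiene false in
/-- evaluation in the special fibre -/
local notation "evκ" =>
  polyEval (𝓞 K ⧸ 𝔭.asIdeal) p (Polynomial.map (Ideal.Quotient.mk 𝔭.asIdeal) f₀) (absIntegersResidue 𝔓)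
set_option hygiene false in
/-- the model `Y^p - f_𝒪` -/
local notation "gmod" => ((X : (absIntegersLocalization 𝔓)[X][Y]) ^ p - C (fLoc f₀ 𝔓))

variable [hirrK : Fact (Irreducible (superellipticPoly K (AlgebraicClosure K) p (fK)))]
  [hirrκ : Fact (Irreducible (superellipticPoly (𝓞 K ⧸ 𝔭.asIdeal) (absIntegers (𝓞 K) K ⧸ 𝔓) p (fk)))]

/-! ### Clearing denominators: `d(x) z = ∑_{i<p} P_i(x) y^i` -/

omit [NumberField K] h𝔓m hirrκ in
/-- **Clearing denominators in `K̄(C_f) = K̄(x)[y]/(y^p - f)`**: every `z` satisfies `d(x) z = ∑_{i<p} P_i(x) y^i` with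
`d ≠ 0` and polynomials `P_i ∈ K̄[X]` (reduce a representative modulo the monic `Y^p - f(x)` and multiply by the
product of the denominators of its coefficients). [folklore] -/
theorem exists_polynomial_mul_eq_sum (z : FK) :
    ∃ d : K̄[X], d ≠ 0 ∧ ∃ P : ℕ → K̄[X],
      algebraMap K̄[X] FK d * z = ∑ i ∈ Finset.range p, algebraMap K̄[X] FK (P i) * genY K K̄ p (fK) ^ i := by
  set F := superellipticPoly K K̄ p (fK) with hF
  have hmon : F.Monic := monic_superellipticPoly K K̄ p (fK) hp.out.ne_zero
  obtain ⟨z', rfl⟩ := AdjoinRoot.mk_surjective z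
  set g := z' %ₘ F with hg
  have hzg : AdjoinRoot.mk F z' = AdjoinRoot.mk F g := by
    rw [AdjoinRoot.mk_eq_mk, hg, modByMonic_eq_sub_mul_div z' F, sub_sub_cancel]
    exact dvd_mul_right _ _
  have hF1 : F ≠ 1 := fun h => hp.out.ne_zero (by
    have h' := congrArg natDegree h
    rwa [hF, natDegree_superellipticPoly, natDegree_one] at h')
  have hdeg : g.natDegree < p := by
    have h := natDegree_modByMonic_lt z' hmon hF1
    rwa [hF, natDegree_superellipticPoly, ← hF] at h
  -- common denominator
  have hden0 : ∀ i, (g.coeff i).denom ≠ 0 := fun i => RatFunc.denom_ne_zero _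
  refine ⟨∏ i ∈ Finset.range p, (g.coeff i).denom, Finset.prod_ne_zero_iff.2 fun i _ => hden0 i,
    fun i => (g.coeff i).num * ∏ j ∈ (Finset.range p).erase i, (g.coeff j).denom, ?_⟩
  have hcoef : ∀ i ∈ Finset.range p,
      algebraMap K̄[X] (RatFunc K̄) ((g.coeff i).num * ∏ j ∈ (Finset.range p).erase i, (g.coeff j).denom) =
        algebraMap K̄[X] (RatFunc K̄) (∏ j ∈ Finset.range p, (g.coeff j).denom) * g.coeff i := by
    intro i hi
    have hdi : algebraMap K̄[X] (RatFunc K̄) (g.coeff i).denom ≠ 0 :=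
      (map_ne_zero_iff _ (IsFractionRing.injective K̄[X] (RatFunc K̄))).2 (hden0 i)
    have hnd := RatFunc.num_div_denom (g.coeff i)
    rw [div_eq_iff hdi] at hnd
    rw [← Finset.mul_prod_erase _ _ hi, map_mul, map_mul, hnd]
    ring
  -- `z = ∑ g_i y^i`
  rw [hzg, ← AdjoinRoot.aeval_eq, aeval_eq_sum_range' hdeg, Finset.mul_sum]
  refine Finset.sum_congr rfl fun i hi => ?_
  rw [IsScalarTower.algebraMap_apply K̄[X] (RatFunc K̄) FK, IsScalarTower.algebraMap_apply K̄[X] (RatFunc K̄) FK,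
    hcoef i hi, map_mul, Algebra.smul_def, mul_assoc]
  rfl

/-! ### Nonvanishing on the special fibre from a unit coefficient -/

omit hirrK in
/-- **`ū(x, y) ≠ 0` when `deg_Y u < p` and `ū ≠ 0`** (`1, ȳ, …, ȳ^{p-1}` are linearly independent over `κ(x̄)`:
`Y^p - f̄` cannot divide a nonzero polynomial of smaller `Y`-degree). [folklore] -/
theorem evκ_ne_zero_of_natDegree_lt {u : (absIntegersLocalization 𝔓)[X][Y]} (hdeg : u.natDegree < p)
    (hu : u.map (mapRingHom (absIntegersResidue 𝔓)) ≠ 0) : evκ u ≠ 0 := by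
  intro h0
  set w := u.map (mapRingHom (absIntegersResidue 𝔓)) with hw
  have h1 : polyEval k𝔭 p (fk) (RingHom.id κ) w = 0 := by
    rw [hw, polyEval_map_mapRingHom, RingHom.id_comp]; exact h0
  have hf : ((fk).map (algebraMap k𝔭 κ)).map (RingHom.id κ) = (fk).map (algebraMap k𝔭 κ) := Polynomial.map_id
  rw [polyEval_eq_zero_iff (RingHom.id κ) hf (fun _ _ h => h) hp.out.ne_zero] at h1
  have h2 := natDegree_le_of_dvd h1 hu
  rw [natDegree_X_pow_sub_C] at h2
  have h3 : w.natDegree ≤ u.natDegree := natDegree_map_le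
  omega

/-! ### Integral primitive models of a family of polynomials -/

/-- **Scaling a family `P_0, …, P_{p-1} ∈ K̄[X]` into `ℤ̄_𝔓` with a unit coefficient**: there are `c₀ ≠ 0` and
`u ∈ ℤ̄_𝔓[X][Y]` of `Y`-degree `< p` with `ū ≠ 0` and `u_i = c₀⁻¹ P_i` (divide all coefficients by one of
maximal `𝔓`-adic size, `exists_div_mem_absIntegersLocalization`). [folklore] -/
theorem exists_integral_model (P : ℕ → K̄[X]) (hP : ∃ i ∈ Finset.range p, P i ≠ 0) :
    ∃ c₀ : K̄, c₀ ≠ 0 ∧ ∃ u : (absIntegersLocalization 𝔓)[X][Y], u.natDegree < p ∧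
      u.map (mapRingHom (absIntegersResidue 𝔓)) ≠ 0 ∧
      ∀ i ∈ Finset.range p, (u.coeff i).map (absIntegersLocalization 𝔓).subtype = C c₀⁻¹ * P i := by
  have hp0 : 0 < p := hp.out.pos
  set B := (Finset.range p).sup fun i => (P i).natDegree with hB
  set s : Finset (ℕ × ℕ) := Finset.range p ×ˢ Finset.range (B + 1) with hs
  obtain ⟨c, hc⟩ : ∃ c : ℕ × ℕ → K̄, ∀ i j, c (i, j) = (P i).coeff j := ⟨fun ij => (P ij.1).coeff ij.2, fun _ _ => rfl⟩
  have hdegP : ∀ i ∈ Finset.range p, (P i).natDegree < B + 1 := fun i hi =>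
    Nat.lt_succ_of_le (Finset.le_sup (f := fun i => (P i).natDegree) hi)
  have hsc : ∃ ij ∈ s, c ij ≠ 0 := by
    obtain ⟨i, hi, hPi⟩ := hP
    refine ⟨(i, (P i).natDegree), Finset.mem_product.2 ⟨hi, Finset.mem_range.2 (hdegP i hi)⟩, ?_⟩
    rw [hc, coeff_natDegree]; exact leadingCoeff_ne_zero.2 hPi
  obtain ⟨ij₀, hij₀, hc₀, hdiv⟩ := exists_div_mem_absIntegersLocalization 𝔓 s c hsc
  set c₀ := c ij₀ with hc₀def
  -- the scaled coefficients, as elements of `ℤ̄_𝔓`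
  let q : ℕ → ℕ → absIntegersLocalization 𝔓 := fun i j =>
    if h : (i, j) ∈ s then ⟨c (i, j) / c₀, hdiv _ h⟩ else 0
  have hq : ∀ i j, (i, j) ∈ s → ((q i j : absIntegersLocalization 𝔓) : K̄) = c (i, j) / c₀ := fun i j h => by
    simp only [q, dif_pos h]
  set u : (absIntegersLocalization 𝔓)[X][Y] :=
    ∑ i ∈ Finset.range p, C (∑ j ∈ Finset.range (B + 1), C (q i j) * X ^ j) * X ^ i with hu
  have hcoeff : ∀ i, u.coeff i = if i ∈ Finset.range p then ∑ j ∈ Finset.range (B + 1), C (q i j) * X ^ j else 0 := by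
    intro i
    rw [hu, finsetSum_coeff]
    simp only [coeff_C_mul_X_pow]
    rw [Finset.sum_ite_eq]
  refine ⟨c₀, hc₀, u, ?_, ?_, ?_⟩
  · -- `deg_Y u < p`
    refine lt_of_le_of_lt (natDegree_sum_le_of_forall_le _ _ fun i hi => ?_) (Nat.sub_lt hp0 Nat.one_pos)
    exact le_trans (natDegree_C_mul_X_pow_le _ _) (Nat.le_sub_one_of_lt (Finset.mem_range.1 hi))
  · -- the coefficient `(i₀, j₀)` of `ū` is `1`
    obtain ⟨hi₀, hj₀⟩ := Finset.mem_product.1 hij₀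
    intro h0
    have h1 := congrArg (fun w => (w.coeff ij₀.1).coeff ij₀.2) h0
    simp only [coeff_map, coeff_zero] at h1
    rw [hcoeff, if_pos hi₀, coe_mapRingHom, coeff_map, finsetSum_coeff] at h1
    simp only [coeff_C_mul_X_pow] at h1
    rw [Finset.sum_ite_eq, if_pos hj₀] at h1
    have h2 : q ij₀.1 ij₀.2 = 1 := Subtype.ext (by rw [hq _ _ hij₀, Subring.coe_one]; exact div_self hc₀)
    rw [h2, map_one] at h1
    exact one_ne_zero h1
  · -- `u_i = c₀⁻¹ P_i`
    intro i hi
    rw [hcoeff, if_pos hi, Polynomial.map_sum, (P i).as_sum_range' (B + 1) (hdegP i hi), Finset.mul_sum]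
    refine Finset.sum_congr rfl fun j hj => ?_
    rw [Polynomial.map_mul, Polynomial.map_pow, map_X, map_C, Subring.coe_subtype,
      hq i j (Finset.mem_product.2 ⟨hi, hj⟩), ← C_mul_X_pow_eq_monomial, ← mul_assoc, ← C_mul, div_eq_inv_mul, hc]

/-! ### Every nonzero function is `c · u(x,y) / v(x,y)` with `ū(x,y), v̄(x,y) ≠ 0` -/

section Rep

variable {ζ₀ : K̄} (hζ₀ : IsPrimitiveRoot ζ₀ p) (hsepK : (fK).Separable)

omit [NumberField K] hp hirrκ in
/-- `u(x, y)` for an integral model: `u(x,y) = c₀⁻¹ ∑ P_i(x) y^i`. [folklore] -/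
theorem ev_eq_of_coeff_eq {u : (absIntegersLocalization 𝔓)[X][Y]} (hdeg : u.natDegree < p) {c₀ : K̄} {P : ℕ → K̄[X]}
    (hcoeffs : ∀ i ∈ Finset.range p, (u.coeff i).map (absIntegersLocalization 𝔓).subtype = C c₀⁻¹ * P i) :
    ev u = algebraMap K̄ FK c₀⁻¹ * ∑ i ∈ Finset.range p, algebraMap K̄[X] FK (P i) * genY K K̄ p (fK) ^ i := by
  rw [polyEval_eq_sum_range (absIntegersLocalization 𝔓).subtype u hdeg, Finset.mul_sum]
  refine Finset.sum_congr rfl fun i hi => ?_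
  rw [hcoeffs i hi, map_mul, IsScalarTower.algebraMap_apply K̄ K̄[X] FK c₀⁻¹, Polynomial.algebraMap_eq, mul_assoc]

/-- **Representation of functions by integral primitive polynomials**: every `z ≠ 0` in `K̄(C_f)` satisfies
`z · v(x,y) = c · u(x,y)` with `u, v ∈ ℤ̄_𝔓[X][Y]` nonvanishing on the special fibre (`ū(x̄,ȳ), v̄(x̄,ȳ) ≠ 0`) and a
constant `c ∈ K̄ˣ`. [cite: Deuring1942Reduktion, §3] -/
theorem exists_mul_ev_eq_smul_ev {z : FK} (hz : z ≠ 0) :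
    ∃ u v : (absIntegersLocalization 𝔓)[X][Y], evκ u ≠ 0 ∧ evκ v ≠ 0 ∧
      ∃ c : K̄, c ≠ 0 ∧ z * ev v = algebraMap K̄ FK c * ev u := by
  have hp0 : 0 < p := hp.out.pos
  obtain ⟨d, hd, P, hdz⟩ := exists_polynomial_mul_eq_sum (K := K) (p := p) (f₀ := f₀) z
  set S := ∑ i ∈ Finset.range p, algebraMap K̄[X] FK (P i) * genY K K̄ p (fK) ^ i with hS
  have hd' : algebraMap K̄[X] FK d ≠ 0 :=
    (map_ne_zero_iff _ (algebraMap_polynomial_injective K K̄ p (fK))).2 hd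
  have hP : ∃ i ∈ Finset.range p, P i ≠ 0 := by
    by_contra h
    simp only [not_exists, not_and, not_not] at h
    have hS0 : S = 0 := Finset.sum_eq_zero fun i hi => by rw [h i hi, map_zero, zero_mul]
    rw [hS0] at hdz
    exact (mul_ne_zero hd' hz) hdz
  -- numerator
  obtain ⟨c₀, hc₀, u, hdegu, hubar, hcoeffu⟩ := exists_integral_model (𝔓 := 𝔓) P hP
  -- denominator: the family `(d, 0, …, 0)`
  let P' : ℕ → K̄[X] := fun i => if i = 0 then d else 0
  have hP'0 : P' 0 = d := if_pos rfl
  have hP'ne : ∀ i, i ≠ 0 → P' i = 0 := fun i hi => if_neg hi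
  have hP'ex : ∃ i ∈ Finset.range p, P' i ≠ 0 := ⟨0, Finset.mem_range.2 hp0, by rw [hP'0]; exact hd⟩
  obtain ⟨c₁, hc₁, v, hdegv, hvbar, hcoeffv⟩ := exists_integral_model (𝔓 := 𝔓) P' hP'ex
  have hS' : ∑ i ∈ Finset.range p, algebraMap K̄[X] FK (P' i) * genY K K̄ p (fK) ^ i = algebraMap K̄[X] FK d := by
    rw [Finset.sum_eq_single_of_mem 0 (Finset.mem_range.2 hp0) fun i _ hi => by rw [hP'ne i hi, map_zero, zero_mul],
      hP'0, pow_zero, mul_one]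
  have hevu : ev u = algebraMap K̄ FK c₀⁻¹ * S := ev_eq_of_coeff_eq hdegu hcoeffu
  have hevv : ev v = algebraMap K̄ FK c₁⁻¹ * algebraMap K̄[X] FK d := by rw [ev_eq_of_coeff_eq hdegv hcoeffv, hS']
  refine ⟨u, v, evκ_ne_zero_of_natDegree_lt hdegu hubar, evκ_ne_zero_of_natDegree_lt hdegv hvbar, c₁⁻¹ * c₀,
    mul_ne_zero (inv_ne_zero hc₁) hc₀, ?_⟩
  rw [hevu, hevv, map_mul, ← mul_assoc z, mul_comm z, mul_assoc _ z, mul_comm z, hdz, hS]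
  rw [mul_assoc, ← mul_assoc (algebraMap K̄ FK c₀), ← map_mul, mul_inv_cancel₀ hc₀, map_one, one_mul]

end Rep

/-! ### Principal divisors reduce to principal divisors -/

section Principal

variable (hp𝔭 : (p : 𝓞 K) ∉ 𝔭.asIdeal) {ζ₀ : K̄} (hζ₀ : IsPrimitiveRoot ζ₀ p) {ζ₀' : κ} (hζ₀' : IsPrimitiveRoot ζ₀' p)
  (hsepK : (fK).Separable) (hsepk : (fk).Separable) (hndvdk : ¬ p ∣ (fk).natDegree)
include hp𝔭 hζ₀ hζ₀' hsepK hsepk hndvdk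

/-- **Deuring's theorem: the reduction of a principal divisor is principal.**  For `z ≠ 0` in `K̄(C_f)` write
`z v(x,y) = c u(x,y)` (`exists_mul_ev_eq_smul_ev`); then `(z)‾ = (u)‾ - (v)‾ = (ū) - (v̄) = (ū/v̄)`.
[cite: Deuring1942Reduktion, §3] -/
theorem isPrincipal_redDiv_principalDivisor {z : FK} (hz : z ≠ 0) :
    (redDiv 𝔭 𝔓 (principalDivisor K̄ z)).IsPrincipal := by
  obtain ⟨u, v, hu, hv, c, hc, heq⟩ := exists_mul_ev_eq_smul_ev (K := K) (p := p) (f₀ := f₀) (𝔓 := 𝔓) (𝔭 := 𝔭) hz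
  have hu0 : ev u ≠ 0 := ev_ne_zero_of_evκ_ne_zero hu
  have hv0 : ev v ≠ 0 := ev_ne_zero_of_evκ_ne_zero hv
  have hdiv : principalDivisor K̄ z = principalDivisor K̄ (ev u) - principalDivisor K̄ (ev v) := by
    have h := congrArg (principalDivisor K̄) heq
    rw [principalDivisor_mul hz hv0, principalDivisor_mul ((_root_.map_ne_zero _).2 hc) hu0, principalDivisor_algebraMap hc,
      zero_add] at h
    rw [← h, add_sub_cancel_right]
  refine ⟨evκ u * (evκ v)⁻¹, mul_ne_zero hu (inv_ne_zero hv), ?_⟩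
  rw [hdiv, map_sub, redDiv_principalDivisor_ev hp𝔭 hζ₀ hζ₀' hsepK hsepk hndvdk hu,
    redDiv_principalDivisor_ev hp𝔭 hζ₀ hζ₀' hsepK hsepk hndvdk hv, principalDivisor_mul hu (inv_ne_zero hv),
    principalDivisor_inv hv, sub_eq_add_neg]

/-- The reduction maps `Princ(K̄(C_f))` into `Princ(κ(C_f̄))`. [cite: Deuring1942Reduktion, §3] -/
theorem principalDivisors_le_comap_redDiv :
    principalDivisors K̄ FK ≤ (principalDivisors κ Fκ).comap (redDiv 𝔭 𝔓) := by
  intro D hD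
  obtain ⟨z, hz, rfl⟩ := mem_principalDivisors_iff.1 hD
  exact mem_principalDivisors_iff.2 (isPrincipal_redDiv_principalDivisor hp𝔭 hζ₀ hζ₀' hsepK hsepk hndvdk hz)

end Principal

end SuperellipticReduction

end Literature.NumberTheory.GaloisRepresentations
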